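import Summits.NavierStokesRegularity.OSWSelfSimilar.SheetRSpectrumOddAssemblyReal
import Summits.NavierStokesRegularity.OSWSelfSimilar.SheetRTimeShiftModeWeak
import Summits.NavierStokesRegularity.OSWSelfSimilar.SheetRLinearisationPerturbation
import HarnessLib

/-!
# SHEET-ℝ frame: the closed operator `T = generatorOdd` (Kato's `−A_F` on the odd class) is DENSELY DEFINED —
# odd `C_c^∞` profiles lie in `D(T)`, and they are dense in `L²_{w,odd}(ℂ)`

HONEST FRAMING (cell ns-blowup GROUP B / zone Z3, case Z3-SR-SPEC, P-list (P9) «C₀-semigroup generation»: the ONE hypothesis of the Hille–Yosida theorem for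
`T = generatorOdd` (selfsim g12 `SheetRResolventOddClass`: closed ✓, resolvent bound `‖R(σ)‖ ≤ 1/(m + Re σ)` ✓, injective ✓) that was not yet in the tree —
cert-5 g6 design memo `P9-P10-RENEWAL-DESIGN.md` §2(a); selfsim g13's Hille–Yosida files (STATUS l.8662) take `Dense (generatorOdd …).domain` as a hypothesis —
here it is a theorem; 1-D MODEL certificate frame (viscous gCLM/OSW sheet on the line); not Euler/NS; «violates: none — MODEL»). Nothing here asserts that a
profile exists; the Gårding datum `h : GardingDataKC …` is the HYPOTHESIS as everywhere in the chain (any drift/potential of record `d, V` with the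
measurability/growth fields, any bounded `K : Esp →L L²_w`).
CONTENT.
* §1 `oddW_mem_Wodd`, `integral_weight_oddW_mul_test` — the odd part `½(g − g∘(−·))` of an `L²_w` class is in `Wodd`, and pairs with every ODD compactly
  supported test exactly as `g` does (the weight is even).
* §2 `eq_zero_of_mem_Wodd_smooth` — density: `g ∈ Wodd` with `∫ w g φ = 0` for every ODD `φ ∈ C_c^∞` is `0` (selfsim's `eq_zero_of_mem_Wodd`, whose proof
  only ever used such `φ`).
* §3 `linForm_smooth_eq_integral` — for `φ ∈ C²` with compact support and a compactly supported test: `linForm L d V φ φ′ v v₁ = ∫ w·(−φ″ + dφ′ + Vφ)·v`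
  (cert-5's `integral_deriv_mul_test`), and `memLp_local_smooth`: `−φ″ + dφ′ + Vφ ∈ L²_w`.
* §4 **`cplx_jmap_mem_domain`** — for an odd `φ ∈ C_c^∞`: the complex class `cplx (jmap (φ, φ′)) ∈ D(T)` (via selfsim's `mem_domain_of_weak`, with the weak
  image `odd part of (−φ″ + dφ′ + Vφ + K(jmap φ))`), and **`dense_domain_generatorOdd`**: `Dense (D(T))` in `Wcodd L` (orthogonal complement `= ⊥` by §2).
No definition (the odd part is written out), no named fact. WHAT THIS IS NOT: not NS; not a semigroup; no number of record moves.
-/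

noncomputable section

namespace Summit.NavierStokesRegularity.OSWSelfSimilar
namespace SheetRGeneratorOddDense

open _root_.MeasureTheory _root_.Set _root_.Filter _root_.Real Literature.Analysis.Fourier SheetRWeakProfilePV SheetRWeakToStrong
  SheetREnergyClass SheetRWeightedMeasure SheetREnergySpace SheetRLinearisedTests SheetRTestSpace SheetRLinearisedFormBounds
  SheetRSolutionOperator SheetRComplexPivot SheetRPerturbedResolventC SheetROddClass SheetRResolventOddClass SheetRGeneratorOddWeak
  SheetREnergySpaceOf SheetRWeakEigenReal SheetRTimeShiftModeWeak SheetRLinearisationPerturbation SheetRSpectrumOddAssemblyReal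
  Literature.Analysis.OperatorTheory Complex
open scoped Topology ENNReal InnerProductSpace ContDiff

variable {L : ℝ}

/-! ### §1 The odd part of an `L²_w` class -/

/-- The odd part `½(g − g∘(−·))` of `g ∈ L²_w` lies in `Wodd`. [folklore] -/
theorem oddW_mem_Wodd (g : W L) : (1 / 2 : ℝ) • (g - reflW L g) ∈ Wodd L := by
  rw [mem_Wodd_iff, map_smul, map_sub, reflW_reflW, ← smul_neg, neg_sub]

/-- The odd part pairs with an ODD compactly supported test like `g` itself (`w` even):
`∫ w·½(g − g∘(−·))·v = ∫ w·g·v`. [folklore] -/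
theorem integral_weight_oddW_mul_test (hL : 0 < L) (g : W L) {v v₁ : ℝ → ℝ} (hv : IsCompactTest v v₁) :
    ∫ y, (L ^ 2 + y ^ 2) * (((((1 / 2 : ℝ) • (g - reflW L g) : W L)) : ℝ → ℝ) y * v y) =
      ∫ y, (L ^ 2 + y ^ 2) * ((g : ℝ → ℝ) y * v y) := by
  rw [integral_weight_mul_eq_Pdata hL _ hv, integral_weight_mul_eq_Pdata hL g hv, map_smul, map_sub, LinearMap.smul_apply,
    LinearMap.sub_apply, smul_eq_mul]
  have hrefl : Pdata hL (reflW L g) ⟨(v, v₁), hv⟩ = -Pdata hL g ⟨(v, v₁), hv⟩ := by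
    rw [Pdata_apply, Pdata_apply]
    have e : ∫ y, (L ^ 2 + y ^ 2) * (((reflW L g : W L) : ℝ → ℝ) y * v y) = ∫ y, (L ^ 2 + y ^ 2) * ((g : ℝ → ℝ) (-y) * v y) :=
      integral_congr_ae ((reflW_ae_volume L hL g).mono fun y hy => by simp only [hy])
    rw [e, ← integral_neg, ← integral_neg_eq_self (fun y => (L ^ 2 + y ^ 2) * ((g : ℝ → ℝ) (-y) * v y)) volume]
    refine integral_congr_ae (Eventually.of_forall fun y => ?_)
    show (L ^ 2 + (-y) ^ 2) * ((g : ℝ → ℝ) (- -y) * v (-y)) = -((L ^ 2 + y ^ 2) * ((g : ℝ → ℝ) y * v y))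
    rw [neg_neg, hv.odd y]; ring
  rw [hrefl]; ring

/-! ### §2 Density of odd smooth compactly supported profiles in the odd class -/

/-- **Density lemma, smooth form.** If `g ∈ Wodd L` and `∫ w g φ = 0` for every ODD `φ ∈ C_c^∞(ℝ)`, then `g = 0`: the odd part of a smooth bump is such a
`φ`, the even part pairs to zero against the odd `w·g`, so `w·g` annihilates `C_c^∞`. (selfsim's `eq_zero_of_mem_Wodd`, same proof.) [folklore] -/
theorem eq_zero_of_mem_Wodd_smooth (hL : 0 < L) {g : W L} (hg : g ∈ Wodd L)
    (h : ∀ φ : ℝ → ℝ, ContDiff ℝ ∞ φ → HasCompactSupport φ → (∀ y, φ (-y) = -φ y) →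
      ∫ y, (L ^ 2 + y ^ 2) * ((g : ℝ → ℝ) y * φ y) = 0) : g = 0 := by
  rw [mem_Wodd_iff_ae L hL] at hg
  have hloc := locallyIntegrable_weight_mul hL g
  have hae : ∀ᵐ y ∂volume, (L ^ 2 + y ^ 2) * (g : ℝ → ℝ) y = 0 := by
    refine ae_eq_zero_of_integral_contDiff_smul_eq_zero hloc fun ψ hψ hsupp => ?_
    have hψc : Continuous ψ := hψ.continuous
    have hψn : Continuous fun x => ψ (-x) := hψc.comp continuous_neg
    have hsuppn : HasCompactSupport fun x => ψ (-x) := hsupp.comp_homeomorph (Homeomorph.neg ℝ)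
    -- the odd part of `ψ` is an odd smooth bump
    have hoddC : ContDiff ℝ ∞ fun x => (ψ x - ψ (-x)) / 2 := (hψ.sub (hψ.comp contDiff_neg)).div_const 2
    have hoddS : HasCompactSupport fun x => (ψ x - ψ (-x)) / 2 := by
      have e : (fun x => (ψ x - ψ (-x)) / 2) = fun x => (1 / 2 : ℝ) * (ψ x - ψ (-x)) := by funext x; ring
      rw [e]
      exact (hsupp.sub hsuppn).mul_left
    have hoddO : ∀ y, (fun x => (ψ x - ψ (-x)) / 2) (-y) = -(fun x => (ψ x - ψ (-x)) / 2) y := fun y => by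
      simp only [neg_neg]; ring
    have hodd := h _ hoddC hoddS hoddO
    have hI1 : Integrable (fun y => ψ y • ((L ^ 2 + y ^ 2) * (g : ℝ → ℝ) y)) := hloc.integrable_smul_left_of_hasCompactSupport hψc hsupp
    have hI2 : Integrable (fun y => ψ (-y) • ((L ^ 2 + y ^ 2) * (g : ℝ → ℝ) y)) :=
      hloc.integrable_smul_left_of_hasCompactSupport hψn hsuppn
    have hIo : Integrable (fun y => ((ψ y - ψ (-y)) / 2) • ((L ^ 2 + y ^ 2) * (g : ℝ → ℝ) y)) :=
      ((hI1.sub hI2).div_const 2).congr (Eventually.of_forall fun y => by simp only [smul_eq_mul, Pi.sub_apply]; ring)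
    have hIe : Integrable (fun y => ((ψ y + ψ (-y)) / 2) • ((L ^ 2 + y ^ 2) * (g : ℝ → ℝ) y)) :=
      ((hI1.add hI2).div_const 2).congr (Eventually.of_forall fun y => by simp only [smul_eq_mul, Pi.add_apply]; ring)
    have hsplit : (fun y => ψ y • ((L ^ 2 + y ^ 2) * (g : ℝ → ℝ) y)) = fun y =>
        ((ψ y - ψ (-y)) / 2) • ((L ^ 2 + y ^ 2) * (g : ℝ → ℝ) y) + ((ψ y + ψ (-y)) / 2) • ((L ^ 2 + y ^ 2) * (g : ℝ → ℝ) y) := by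
      funext y; simp only [smul_eq_mul]; ring
    rw [hsplit, integral_add hIo hIe]
    have h1 : ∫ y, ((ψ y - ψ (-y)) / 2) • ((L ^ 2 + y ^ 2) * (g : ℝ → ℝ) y) = 0 := by
      rw [← hodd]
      refine integral_congr_ae (Eventually.of_forall fun y => ?_)
      simp only [smul_eq_mul]; ring
    have h2 : ∫ y, ((ψ y + ψ (-y)) / 2) • ((L ^ 2 + y ^ 2) * (g : ℝ → ℝ) y) = 0 := by
      refine integral_eq_zero_of_ae_odd ?_
      filter_upwards [hg] with y hy
      simp only [smul_eq_mul, neg_neg, neg_sq, hy]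
      ring
    rw [h1, h2, add_zero]
  have hg0 : (g : ℝ → ℝ) =ᵐ[volume] 0 := by
    filter_upwards [hae] with y hy
    have hw : 0 < L ^ 2 + y ^ 2 := by positivity
    rcases mul_eq_zero.1 hy with h0 | h0
    · exact absurd h0 hw.ne'
    · exact h0
  exact (Lp.eq_zero_iff_ae_eq_zero).2 (ae_μw_of_ae_volume hg0)

/-! ### §3 The local part on a smooth compactly supported profile -/

variable {d V : ℝ → ℝ} {D₀ D₁ V₀ : ℝ}

/-- For `φ ∈ C²` with compact support: `−φ″ + dφ′ + Vφ ∈ L²_w` (bounded, measurable, compactly supported). [folklore] -/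
theorem memLp_local_smooth (hdm : AEStronglyMeasurable d volume) (hVm : AEStronglyMeasurable V volume) (hD₀ : 0 ≤ D₀) (hD₁ : 0 ≤ D₁)
    (hd : ∀ ξ, |d ξ| ≤ D₀ + D₁ * |ξ|) (hV : ∀ ξ, |V ξ| ≤ V₀) {φ : ℝ → ℝ} (hφ : ContDiff ℝ 2 φ) (hφc : HasCompactSupport φ) :
    MemLp (fun y => -deriv (deriv φ) y + d y * deriv φ y + V y * φ y) 2 (μw L) := by
  have hφ1 : ContDiff ℝ 1 (deriv φ) := (contDiff_succ_iff_deriv.1 hφ).2.2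
  have hc0 : Continuous φ := hφ.continuous
  have hc1 : Continuous (deriv φ) := hφ1.continuous
  have hc2 : Continuous (deriv (deriv φ)) := hφ1.continuous_deriv le_rfl
  have hs1 : HasCompactSupport (deriv φ) := hφc.deriv
  have hs2 : HasCompactSupport (deriv (deriv φ)) := hs1.deriv
  have hmeas : AEStronglyMeasurable (fun y => -deriv (deriv φ) y + d y * deriv φ y + V y * φ y) volume :=
    ((hc2.aestronglyMeasurable.neg).add (hdm.mul hc1.aestronglyMeasurable)).add (hVm.mul hc0.aestronglyMeasurable)
  refine memLp_W hmeas ?_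
  -- domination by a continuous compactly supported function
  have hdom : Integrable fun y => (L ^ 2 + y ^ 2) * (3 * (deriv (deriv φ) y ^ 2 + (D₀ + D₁ * |y|) ^ 2 * deriv φ y ^ 2 + V₀ ^ 2 * φ y ^ 2)) := by
    refine Continuous.integrable_of_hasCompactSupport (by fun_prop) ?_
    have e : (fun y => (L ^ 2 + y ^ 2) * (3 * (deriv (deriv φ) y ^ 2 + (D₀ + D₁ * |y|) ^ 2 * deriv φ y ^ 2 + V₀ ^ 2 * φ y ^ 2))) =
        (fun y => (L ^ 2 + y ^ 2) * 3 * deriv (deriv φ) y) * deriv (deriv φ)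
          + (fun y => (L ^ 2 + y ^ 2) * 3 * (D₀ + D₁ * |y|) ^ 2 * deriv φ y) * deriv φ + (fun y => (L ^ 2 + y ^ 2) * 3 * V₀ ^ 2 * φ y) * φ := by
      funext y; simp only [Pi.add_apply, Pi.mul_apply]; ring
    rw [e]
    exact ((hs2.mul_left).add hs1.mul_left).add hφc.mul_left
  refine hdom.mono' ((by fun_prop : AEStronglyMeasurable (fun y : ℝ => L ^ 2 + y ^ 2) volume).mul (hmeas.pow 2)) ?_
  refine Eventually.of_forall fun y => ?_
  have hw : 0 ≤ L ^ 2 + y ^ 2 := by positivity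
  rw [Real.norm_eq_abs, abs_mul, abs_of_nonneg hw, abs_of_nonneg (sq_nonneg _)]
  refine mul_le_mul_of_nonneg_left ?_ hw
  have h1 : |d y * deriv φ y| ≤ (D₀ + D₁ * |y|) * |deriv φ y| := by
    rw [abs_mul]; exact mul_le_mul_of_nonneg_right (hd y) (abs_nonneg _)
  have h2 : |V y * φ y| ≤ V₀ * |φ y| := by
    rw [abs_mul]; exact mul_le_mul_of_nonneg_right (hV y) (abs_nonneg _)
  have hD : 0 ≤ D₀ + D₁ * |y| := by positivity
  nlinarith [sq_abs (d y * deriv φ y), sq_abs (V y * φ y), sq_abs (deriv φ y), sq_abs (φ y), abs_nonneg (d y * deriv φ y), abs_nonneg (V y * φ y),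
    mul_nonneg hD (abs_nonneg (deriv φ y)), mul_nonneg (le_trans (abs_nonneg _) (hV y)) (abs_nonneg (φ y)),
    sq_nonneg (-deriv (deriv φ) y - d y * deriv φ y), sq_nonneg (-deriv (deriv φ) y - V y * φ y), sq_nonneg (d y * deriv φ y - V y * φ y)]

/-- **The weak form of the local operator on a smooth compactly supported profile** is the pairing with `−φ″ + dφ′ + Vφ`: for `φ ∈ C²` with compact
support and every compactly supported test, `linForm L d V φ φ′ v v₁ = ∫ w·(−φ″ + dφ′ + Vφ)·v` (one integration by parts, `integral_deriv_mul_test`). [folklore] -/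
theorem linForm_smooth_eq_integral (hL : 0 < L) (hdm : AEStronglyMeasurable d volume) (hVm : AEStronglyMeasurable V volume) (hD₀ : 0 ≤ D₀)
    (hD₁ : 0 ≤ D₁) (hd : ∀ ξ, |d ξ| ≤ D₀ + D₁ * |ξ|) (hV : ∀ ξ, |V ξ| ≤ V₀) {φ : ℝ → ℝ} (hφ : ContDiff ℝ 2 φ) (hφc : HasCompactSupport φ)
    {v v₁ : ℝ → ℝ} (hv : IsCompactTest v v₁) :
    linForm L d V φ (deriv φ) v v₁ = ∫ y, (L ^ 2 + y ^ 2) * ((-deriv (deriv φ) y + d y * deriv φ y + V y * φ y) * v y) := by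
  obtain ⟨hvc, -, -, B, hB0, hB⟩ := basic_of_isCompactTest hv
  have hvK := hasCompactSupport_of_isCompactTest hv
  have hφ1 : ContDiff ℝ 1 (deriv φ) := (contDiff_succ_iff_deriv.1 hφ).2.2
  have hc0 : Continuous φ := hφ.continuous
  have hc1 : Continuous (deriv φ) := hφ1.continuous
  have hc2 : Continuous (deriv (deriv φ)) := hφ1.continuous_deriv le_rfl
  have hd1 : ∀ y, HasDerivAt (deriv φ) (deriv (deriv φ) y) y := fun y => ((hφ1.differentiable one_ne_zero) y).hasDerivAt
  -- weights of `φ`, `φ′` (continuous with compact support)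
  have hw0 : Integrable fun y => (L ^ 2 + y ^ 2) * φ y ^ 2 := by
    have e : (fun y => (L ^ 2 + y ^ 2) * φ y ^ 2) = (fun y => (L ^ 2 + y ^ 2) * φ y) * φ := by funext y; simp only [Pi.mul_apply]; ring
    rw [e]; exact Continuous.integrable_of_hasCompactSupport (by fun_prop) hφc.mul_left
  have hw1 : Integrable fun y => (L ^ 2 + y ^ 2) * deriv φ y ^ 2 := by
    have e : (fun y => (L ^ 2 + y ^ 2) * deriv φ y ^ 2) = (fun y => (L ^ 2 + y ^ 2) * deriv φ y) * deriv φ := by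
      funext y; simp only [Pi.mul_apply]; ring
    rw [e]; exact Continuous.integrable_of_hasCompactSupport (by fun_prop) hφc.deriv.mul_left
  obtain ⟨hI, -⟩ := abs_linForm_le (d := d) (V := V) hL hdm hVm hD₁ hd hV hv hc0.aestronglyMeasurable hc1.aestronglyMeasurable hw0 hw1
  -- the multiplier `g = w·φ′` and integration by parts
  set g : ℝ → ℝ := fun y => (L ^ 2 + y ^ 2) * deriv φ y with hg
  have hgC : ContDiff ℝ 1 g := by rw [hg]; exact (by fun_prop : ContDiff ℝ 1 fun y : ℝ => L ^ 2 + y ^ 2).mul hφ1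
  have hgd : ∀ y, deriv g y = 2 * y * deriv φ y + (L ^ 2 + y ^ 2) * deriv (deriv φ) y := by
    intro y
    have hw : HasDerivAt (fun y : ℝ => L ^ 2 + y ^ 2) (2 * y) y := by
      have := ((hasDerivAt_id y).pow 2).const_add (L ^ 2)
      simpa using this
    have h : HasDerivAt (fun y => (L ^ 2 + y ^ 2) * deriv φ y) (2 * y * deriv φ y + (L ^ 2 + y ^ 2) * deriv (deriv φ) y) y := hw.mul (hd1 y)
    rw [hg, h.deriv]
  have hA := integral_deriv_mul_test hgC hv
  have hG2 : Integrable fun y => deriv g y * v y := Continuous.integrable_of_hasCompactSupport ((hgC.continuous_deriv le_rfl).mul hvc) hvK.mul_left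
  -- the target integrand is integrable: it is `I − (w φ′ v₁ + g′ v)` and `w φ′ v₁ = I − … ` … simplest: continuity + compact support of `v` EXCEPT the `φ₁`-free
  -- terms; we use the pointwise identity instead
  have key : ∀ y, ((L ^ 2 + y ^ 2) * (deriv φ y * v₁ y) + 2 * y * (deriv φ y * v y) + (L ^ 2 + y ^ 2) * d y * (deriv φ y * v y)
        + (L ^ 2 + y ^ 2) * V y * (φ y * v y))
      - (L ^ 2 + y ^ 2) * ((-deriv (deriv φ) y + d y * deriv φ y + V y * φ y) * v y) = (L ^ 2 + y ^ 2) * deriv φ y * v₁ y + deriv g y * v y := by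
    intro y; rw [hgd y]; ring
  have hT : Integrable fun y => (L ^ 2 + y ^ 2) * ((-deriv (deriv φ) y + d y * deriv φ y + V y * φ y) * v y) := by
    -- `w·q·v` with `q ∈ L²_w` and `v` a test
    have hq := memLp_local_smooth (L := L) hdm hVm hD₀ hD₁ hd hV hφ hφc
    have h := integrable_weight_mul_test hL (hq.toLp _) hv
    refine h.congr ?_
    filter_upwards [ae_volume_of_ae_μw hL (MemLp.coeFn_toLp hq)] with y hy
    rw [hy]
  have hG1 : Integrable fun y => (L ^ 2 + y ^ 2) * deriv φ y * v₁ y := by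
    refine ((hI.sub hT).sub hG2).congr (Eventually.of_forall fun y => ?_)
    simp only [Pi.sub_apply]
    linarith [key y]
  have hlin : linForm L d V φ (deriv φ) v v₁ =
      ∫ y, ((L ^ 2 + y ^ 2) * (deriv φ y * v₁ y) + 2 * y * (deriv φ y * v y) + (L ^ 2 + y ^ 2) * d y * (deriv φ y * v y)
          + (L ^ 2 + y ^ 2) * V y * (φ y * v y)) := rfl
  have eSub := integral_sub hI hT
  have eKey : ∫ y, (((L ^ 2 + y ^ 2) * (deriv φ y * v₁ y) + 2 * y * (deriv φ y * v y) + (L ^ 2 + y ^ 2) * d y * (deriv φ y * v y)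
        + (L ^ 2 + y ^ 2) * V y * (φ y * v y))
      - (L ^ 2 + y ^ 2) * ((-deriv (deriv φ) y + d y * deriv φ y + V y * φ y) * v y)) =
      (∫ y, (L ^ 2 + y ^ 2) * deriv φ y * v₁ y) + ∫ y, deriv g y * v y := by
    rw [← integral_add hG1 hG2]; exact integral_congr_ae (Eventually.of_forall key)
  have hgφ : ∫ y, g y * v₁ y = ∫ y, (L ^ 2 + y ^ 2) * deriv φ y * v₁ y := rfl
  rw [hlin]
  linarith

/-! ### §4 Odd smooth compactly supported profiles lie in `D(T)`; `D(T)` is dense -/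

/-- An odd `φ ∈ C_c^∞` with its derivative is a compactly supported test. [folklore] -/
theorem isCompactTest_of_smooth_odd {φ : ℝ → ℝ} (hφ : ContDiff ℝ ∞ φ) (hφc : HasCompactSupport φ) (hodd : ∀ y, φ (-y) = -φ y) :
    IsCompactTest φ (deriv φ) := by
  have h := isCompactTest_oddPart (hφ.of_le (by exact_mod_cast le_top)) hφc
  have e : (fun x => (φ x - φ (-x)) / 2) = φ := by funext x; rw [hodd x]; ring
  rwa [e] at h

variable {c m : ℝ}

/-- **Odd smooth compactly supported profiles lie in `D(T)`.** For an odd `φ ∈ C_c^∞` and its energy-space element `p = jmap (φ, φ′)`: the complex class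
`cplx p = ιE p + 0i` lies in the domain of `generatorOdd` — its weak image is the odd part of `−φ″ + dφ′ + Vφ + K p ∈ L²_w` (selfsim's `mem_domain_of_weak`).
[folklore] -/
theorem cplx_jmap_mem_domain (hL : 0 < L) (K : Esp L hL →L[ℝ] W L) (h : GardingDataKC L hL d V K D₀ D₁ V₀ c m) {σ₀ : ℂ} (hσ₀ : -m < σ₀.re)
    {φ : ℝ → ℝ} (hφ : ContDiff ℝ ∞ φ) (hφc : HasCompactSupport φ) (hodd : ∀ y, φ (-y) = -φ y) :
    cplx hL (jmap hL ⟨(φ, deriv φ), isCompactTest_of_smooth_odd hφ hφc hodd⟩) ∈ (generatorOdd hL K h σ₀ hσ₀).domain := by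
  set vp : testSpace := ⟨(φ, deriv φ), isCompactTest_of_smooth_odd hφ hφc hodd⟩ with hvp
  set p : Esp L hL := jmap hL vp with hpdef
  have hφ2 : ContDiff ℝ 2 φ := hφ.of_le (WithTop.coe_le_coe.2 le_top)
  have hq := memLp_local_smooth (L := L) h.d_meas h.V_meas h.D₀_nonneg h.D₁_nonneg h.d_le h.V_le hφ2 hφc
  set g : W L := hq.toLp _ + K p with hgdef
  set gO : W L := (1 / 2 : ℝ) • (g - reflW L g) with hgO
  have hgOodd : gO ∈ Wodd L := oddW_mem_Wodd g
  set F : Wcodd L := ⟨ofPair L (WithLp.toLp 2 (gO, (0 : W L))), ofPair_mem_Wcodd L hgOodd (Submodule.zero_mem _)⟩ with hFdef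
  refine (mem_domain_of_weak hL K h hσ₀ (u := cplx hL p) (F := F) (P := WithLp.toLp 2 (p, (0 : Esp L hL))) (toPair_cplx hL p) ?_).1
  -- the weak image identity
  obtain ⟨hdm, hVm, hd, hV⟩ : AEStronglyMeasurable d volume ∧ AEStronglyMeasurable V volume ∧ (∀ ξ, |d ξ| ≤ D₀ + D₁ * |ξ|) ∧ ∀ ξ, |V ξ| ≤ V₀ :=
    ⟨h.d_meas, h.V_meas, h.d_le, h.V_le⟩
  obtain ⟨hae, hprim⟩ := jmap_snd_ae hL vp
  have hre : reW L (F : Wc L) = gO := by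
    show reW L (ofPair L (WithLp.toLp 2 (gO, (0 : W L)))) = gO
    rw [← (toPair_fst_snd _).1, toPair_ofPair]; rfl
  have him : imW L (F : Wc L) = 0 := by
    show imW L (ofPair L (WithLp.toLp 2 (gO, (0 : W L)))) = 0
    rw [← (toPair_fst_snd _).2, toPair_ofPair]; rfl
  intro v v₁ hv
  have hfst : (WithLp.toLp 2 (p, (0 : Esp L hL))).fst = p := rfl
  have hsnd : (WithLp.toLp 2 (p, (0 : Esp L hL))).snd = 0 := rfl
  rw [hfst, hsnd, hre, him]
  refine ⟨?_, ?_⟩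
  · -- first component: linForm(φ) + ∫ w (K p) v = ∫ w gO v = ∫ w g v = ∫ w q v + ∫ w (K p) v
    have hlinp : linForm L d V (prim (der p)) (der p) v v₁ = linForm L d V φ (deriv φ) v v₁ :=
      linForm_congr_ae L d V (Eventually.of_forall fun y => congrFun hprim y) hae
    rw [hlinp, linForm_smooth_eq_integral hL hdm hVm h.D₀_nonneg h.D₁_nonneg hd hV hφ2 hφc hv, hgO,
      integral_weight_oddW_mul_test hL g hv, hgdef, integral_weight_mul_eq_Pdata hL (hq.toLp _ + K p) hv, map_add (Pdata hL),
      LinearMap.add_apply, ← integral_weight_mul_eq_Pdata hL _ hv, ← integral_weight_mul_eq_Pdata hL _ hv]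
    congr 1
    refine integral_congr_ae ?_
    filter_upwards [ae_volume_of_ae_μw hL (MemLp.coeFn_toLp hq)] with y hy
    rw [hy]
  · -- second component: everything vanishes
    have hz : linForm L d V (prim (der (0 : Esp L hL))) (der (0 : Esp L hL)) v v₁ = 0 := by
      have e := (Eform_apply hL hdm hVm h.D₁_nonneg hd hV (0 : Esp L hL) ⟨(v, v₁), hv⟩).symm
      rw [map_zero, LinearMap.zero_apply] at e
      exact e
    rw [hz, map_zero, integral_weight_mul_eq_Pdata hL (0 : W L) hv, map_zero, LinearMap.zero_apply]
    simp

/-- **`D(T)` IS DENSE in `L²_{w,odd}(ℂ)`.** The orthogonal complement of the domain of `generatorOdd` inside the Hilbert space `Wcodd L` is trivial: a `G ⊥ D(T)`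
pairs to zero with `φ + 0i` for every odd `φ ∈ C_c^∞`, so `Re G` and `Im G` vanish by the density lemma. (The remaining Hille–Yosida hypothesis for (P9).)
[folklore] -/
theorem dense_domain_generatorOdd (hL : 0 < L) (K : Esp L hL →L[ℝ] W L) (h : GardingDataKC L hL d V K D₀ D₁ V₀ c m) {σ₀ : ℂ} (hσ₀ : -m < σ₀.re) :
    Dense ((generatorOdd hL K h σ₀ hσ₀).domain : Set (Wcodd L)) := by
  haveI : CompleteSpace (Wcodd L) := completeSpace_Wcodd L
  rw [Submodule.dense_iff_topologicalClosure_eq_top, Submodule.topologicalClosure_eq_top_iff, Submodule.eq_bot_iff]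
  intro G hG
  rw [Submodule.mem_orthogonal'] at hG
  -- `Re G`, `Im G` are odd real classes pairing to zero with every odd smooth bump
  obtain ⟨hGR, hGI⟩ := (mem_Wcodd_iff L (G : Wc L)).1 G.2
  have hpair : ∀ φ : ℝ → ℝ, ContDiff ℝ ∞ φ → HasCompactSupport φ → (∀ y, φ (-y) = -φ y) →
      (∫ y, (L ^ 2 + y ^ 2) * (((reW L (G : Wc L) : W L) : ℝ → ℝ) y * φ y) = 0) ∧
        ∫ y, (L ^ 2 + y ^ 2) * (((imW L (G : Wc L) : W L) : ℝ → ℝ) y * φ y) = 0 := by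
    intro φ hφ hφc hodd
    set p : Esp L hL := jmap hL ⟨(φ, deriv φ), isCompactTest_of_smooth_odd hφ hφc hodd⟩ with hpdef
    have hmem := cplx_jmap_mem_domain hL K h hσ₀ hφ hφc hodd
    have h0 := hG _ hmem
    rw [Submodule.coe_inner, coe_cplx] at h0
    -- `⟪G, ιE p + 0i⟫ = ⟪Re G, ιE p⟫ − i⟪Im G, ιE p⟫`
    have hsplit : (G : Wc L) = ofRealW L (reW L (G : Wc L)) + (Complex.I : ℂ) • ofRealW L (imW L (G : Wc L)) := by
      conv_lhs => rw [← ofPair_toPair (G : Wc L)]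
      rw [ofPair_apply, (toPair_fst_snd _).1, (toPair_fst_snd _).2]
    rw [hsplit, inner_add_left, inner_smul_left, inner_ofRealW, inner_ofRealW, Complex.conj_I] at h0
    have hre := congrArg Complex.re h0
    have him := congrArg Complex.im h0
    simp only [Complex.add_re, Complex.add_im, Complex.mul_re, Complex.mul_im, Complex.neg_re, Complex.neg_im, Complex.I_re, Complex.I_im,
      Complex.ofReal_re, Complex.ofReal_im, Complex.zero_re, Complex.zero_im] at hre him
    -- real inner products as weighted integrals
    have hι : ((ιE hL p : W L) : ℝ → ℝ) =ᵐ[volume] φ := by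
      have h1 := ιE_ae hL p
      rw [hpdef, (jmap_snd_ae hL _).2] at h1
      exact h1
    have hinner : ∀ gR : W L, ⟪gR, ιE hL p⟫_ℝ = ∫ y, (L ^ 2 + y ^ 2) * ((gR : ℝ → ℝ) y * φ y) := by
      intro gR
      rw [L2.inner_def]
      have key : ∫ a, ⟪((gR : W L) : ℝ → ℝ) a, ((ιE hL p : W L) : ℝ → ℝ) a⟫_ℝ ∂(μw L) =
          ∫ y, (L ^ 2 + y ^ 2) * ⟪((gR : W L) : ℝ → ℝ) y, ((ιE hL p : W L) : ℝ → ℝ) y⟫_ℝ :=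
        integral_withDensity_weight L _
      rw [key]
      refine integral_congr_ae ?_
      filter_upwards [hι] with y hy
      rw [RCLike.inner_apply, conj_trivial, hy]; ring
    rw [← hpdef] at hre him
    simp only [hinner, neg_zero, zero_mul, mul_zero, sub_zero, zero_add, add_zero, neg_mul, one_mul] at hre him
    constructor
    · linarith
    · linarith
  have hR0 : reW L (G : Wc L) = 0 := eq_zero_of_mem_Wodd_smooth hL hGR fun φ hφ hφc hodd => (hpair φ hφ hφc hodd).1
  have hI0 : imW L (G : Wc L) = 0 := eq_zero_of_mem_Wodd_smooth hL hGI fun φ hφ hφc hodd => (hpair φ hφ hφc hodd).2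
  apply Subtype.ext
  rw [Submodule.coe_zero, ← ofPair_toPair (G : Wc L)]
  have h1 : (toPair L (G : Wc L)).fst = (0 : WithLp 2 (W L × W L)).fst := by rw [(toPair_fst_snd _).1, hR0, WithLp.zero_fst]
  have h2 : (toPair L (G : Wc L)).snd = (0 : WithLp 2 (W L × W L)).snd := by rw [(toPair_fst_snd _).2, hI0, WithLp.zero_snd]
  have : toPair L (G : Wc L) = 0 := WithLp.ofLp_injective 2 (Prod.ext h1 h2)
  rw [this, map_zero]

end SheetRGeneratorOddDense
end Summit.NavierStokesRegularity.OSWSelfSimilar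

end
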